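/-
Copyright (c) 2026 the pub-hodgecm-mathlib formalisation cell (harness21).  Prover seat hodgecm-mathlib-K2E3-p12 (g8), Track B ∕ K2-LIT, h413 = `stmt-HodgeConjecture-24833`,
line `K2_E1_TraceFormulaBeta`, 5Res ROADCARD «ENDGAME BY FAMILIES» (K2E1-plan (g7), (154)∕(260)): the self-dual two-term formula of ★ H-c in VECTOR-GRAM currency — the `t`-integral OUTSIDE,
the `w = w₀` coefficient as the sesquilinear section pairing `B_z(φ, φ′) = (ν𝓕)⁻¹·∫_{K_U} φ·conj I_{φ′}(z̄,·) dμ_K` — the shape of the `hSD` letter of ★ `K2E1ChiSectionPlancherelSelfDualCMTwo` :184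
(whose `⟪v_b, M z v_a⟫` is `B_z(φ_a, φ_b)` once `M z` is the Riesz operator of `B_z` on the finite-dimensional span).
-/
import Summits.HodgeConjecture.HodgeConjecture.Theorems.K2E1ChiPseudoEisensteinSelfDualCMTwo     -- ★ H-c p860715 (this seat): (SD) two-term formula, §1∕§2 tools
import HarnessLib

/-!
# (260) — `K2E1ChiPseudoEisensteinSelfDualVectorGramCMTwo`: (SD) IN VECTOR-GRAM CURRENCY
# `⟨θ_{f,φ}, θ_{f′,φ′}⟩_X = C·(2π)⁻¹∫_ℝ f̃(z)·( ⟪φ,φ′⟫_K·conj f̃′(−(1−z̄)) + B_z(φ,φ′)·conj f̃′(−z̄) ) dt`, `B_z(φ,φ′) = (ν𝓕)⁻¹∫_{K_U} φ(k)·conj I_{φ′}(z̄,k) dμ_K`, `z = σ₀ + it`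

Track B ∕ K2-LIT, crux h413 = `stmt-HodgeConjecture-24833`, route of record `HCCMUnconditional`; cell `hodgecm-mathlib`, squad K2, ENGINE E1.  THEOREMS ONLY (no `def`, no `instance`,
no `notation`, no named-fact hypothesis, no `sorry`); lane `--supports stmt-HodgeConjecture-24833 --as helper` (count-neutral).
THE MATHEMATICS ([MoeglinWaldspurger1995, II.2.1]; ROADCARD (154) §1 (SD); ★ `K2E1ChiSectionPlancherelSelfDualCMTwo` `hSD`).  ★ H-c gives the two terms as `(2π)⁻¹∫ f̃ conj f̃′(z̄−1)·⟪φ,φ′⟫`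
plus `(ν𝓕)⁻¹•∫_{K_U} φ(k)·((2π)⁻¹∫_ℝ f̃(z)conj f̃′(z̄)·conj I_{φ′}(z̄,k) dt) dμ_K`.  Here (§1) the `K_U × ℝ` integrand `φ(k)·f̃(z)·conj f̃′(z̄)·conj I_{φ′}(z̄,k)` is jointly Borel (parametric-integral
tower) and dominated by `C_φ·|f̃(z_t)|·B′·C_{φ′}c₀` (`|f̃′(−z̄)| ≤ B′` on the line ★ A `norm_mellin_le`; uniform Godement bound ★ H-a §1 at `z̄`, `Re z̄ = σ₀ > 1`), so FUBINI swaps `∫_{K_U}` and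
`∫_ℝ`; (§2) the two `t`-integrals merge (`conj f̃′(z̄ − 1) = conj f̃′(−(1 − z̄))`), giving the VECTOR-GRAM shape with the sesquilinear coefficient `B_z(φ,φ′)` — linear in `φ`, conjugate-linear
in `φ′` — in place of `⟪v_b, M z v_a⟫`.
* §1 `integrable_selfDual_w0_prod_cm_two`.  * §2 **`chiPseudoEisenstein_inner_product_selfDual_vectorGram_cm_two`**.
HONEST LABEL: HC_CM is proved only modulo the 7 printed citations (2 remaining named inputs: hLiu418 = `stmt-HodgeConjecture-24832`, h413 = `stmt-HodgeConjecture-24833`) until rung 0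
closes; this file asserts no named fact, closes no socket; count-neutral; letter-free.

## References
* [MoeglinWaldspurger1995] C. Mœglin, J.-L. Waldspurger, *Spectral decomposition and Eisenstein series* (1995), II.2.1.
* [Titchmarsh1948] E. C. Titchmarsh, *Introduction to the Theory of Fourier Integrals* (1948), Thm 71–72.
-/

set_option autoImplicit false
set_option linter.dupNamespace false  -- the mandated namespace repeats the summit's segment (`HodgeConjecture.HodgeConjecture`)

noncomputable section

open MeasureTheory Measure Set Filter Topology Complex NumberField IsDedekindDomain MulAction
open scoped Real NNReal ENNReal ComplexConjugate Pointwise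
open Literature.MeasureTheory.Group Literature.NumberTheory
open Literature.NumberTheory.Automorphic Literature.NumberTheory.Automorphic.UnitaryGroup AdelicGroupData
open Literature.NumberTheory.GaloisRepresentations (HeckeCharacter ideleGroup)
open Summit.HodgeConjecture.HodgeConjecture.Cruxes.H413.K2E1BorelEisensteinU
open Summit.HodgeConjecture.HodgeConjecture.Cruxes.H413.K2E1CharacterEisensteinU2Defs
open Summit.HodgeConjecture.HodgeConjecture.Cruxes.H413.K2E1MellinPaleyWienerHalfLine (differentiable_mellin norm_mellin_le)
open Summit.HodgeConjecture.HodgeConjecture.Cruxes.H413.K2E1PseudoEisensteinInnerProductCMTwoFinal (continuous_and_integrable_norm_mellin_neg)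
open Summit.HodgeConjecture.HodgeConjecture.Cruxes.H413.K2E1ChiPseudoEisensteinIdeleSplitCMTwo (norm_integral_flatSectionU_weylLongU_maximalCompact_le_cm_two)
open Summit.HodgeConjecture.HodgeConjecture.Cruxes.H413.K2E1ChiPseudoEisensteinSelfDualCMTwo (chiPseudoEisenstein_inner_product_selfDual_cm_two)
open Summit.HodgeConjecture.HodgeConjecture.Cruxes.H413.K2E1SphericalIntertwiningMellinCMTwo (sigmaFinite_haar_adelicUnipotent_cm_two)

namespace Summit.HodgeConjecture.HodgeConjecture.Cruxes.H413.K2E1ChiPseudoEisensteinSelfDualVectorGramCMTwo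

variable (L : Type) [Field L] [NumberField L] [IsCMField L]
variable [MeasurableSpace (quasiSplit (↥(maximalRealSubfield L)) L (IsCMField.complexConj L) 2).Adelic] [BorelSpace (quasiSplit (↥(maximalRealSubfield L)) L (IsCMField.complexConj L) 2).Adelic]

/-! ## §1 Fubini on `K_U × ℝ` for the `w = w₀` Gram integrand -/

/-- **The `K_U × ℝ` integrand `φ(k)·f̃(z_t)·conj f̃′(−z̄_t)·conj I_{φ′}(z̄_t, k)` is integrable** (`z_t = σ₀ + it`, `σ₀ > 1`): jointly Borel (parametric-integral tower), dominated by
`C_φ·|f̃(−z_t)|·(∫ r^{−σ₀−1}|f′|)·C_{φ′}·c₀` with `|f̃(−z_t)| ∈ L¹(dt)` (★ A) and `μ_K` finite. [cite: MoeglinWaldspurger1995, II.2.1] [cite: Titchmarsh1948, Thm 71] -/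
theorem integrable_selfDual_w0_prod_cm_two (ν : Measure ↥(adelicUnipotent (↥(maximalRealSubfield L)) L (IsCMField.complexConj L) 2)) [ν.IsHaarMeasure] {𝓕 : Set ↥(adelicUnipotent (↥(maximalRealSubfield L)) L (IsCMField.complexConj L) 2)}
    (h𝓕N : IsFundamentalDomain ↥(rationalUnipotent (↥(maximalRealSubfield L)) L (IsCMField.complexConj L) 2) 𝓕 ν) (h𝓕c : IsCompact (closure 𝓕)) (μK : Measure ((standardMaximalCompactGL 2 L).comap (adelicVal (↥(maximalRealSubfield L)) L (IsCMField.complexConj L) 2 ((StdForm.antidiagonal 2).over L)) : Subgroup (quasiSplit (↥(maximalRealSubfield L)) L (IsCMField.complexConj L) 2).Adelic)) [IsFiniteMeasure μK]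
    {φ φ' : (quasiSplit (↥(maximalRealSubfield L)) L (IsCMField.complexConj L) 2).Adelic → ℂ} (hφc : Continuous φ) {Cφ : ℝ} (hφC : ∀ x, ‖φ x‖ ≤ Cφ) (hφ'c : Continuous φ') {Cφ' : ℝ} (hφ'C : ∀ x, ‖φ' x‖ ≤ Cφ')
    {f f' : ℝ → ℂ} (hf : ContDiff ℝ 2 f) (hfs : HasCompactSupport f) (hf0 : tsupport f ⊆ Ioi 0) (hf' : ContDiff ℝ 2 f') (hf's : HasCompactSupport f') (hf'0 : tsupport f' ⊆ Ioi 0)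
    {σ₀ : ℝ} (hσ₀ : 1 < σ₀) :
    Integrable (Function.uncurry fun (k : ((standardMaximalCompactGL 2 L).comap (adelicVal (↥(maximalRealSubfield L)) L (IsCMField.complexConj L) 2 ((StdForm.antidiagonal 2).over L)) : Subgroup (quasiSplit (↥(maximalRealSubfield L)) L (IsCMField.complexConj L) 2).Adelic)) (t : ℝ) => φ (k : (quasiSplit (↥(maximalRealSubfield L)) L (IsCMField.complexConj L) 2).Adelic) * (mellin f (-((σ₀ : ℂ) + t * I)) * conj (mellin f' (-conj ((σ₀ : ℂ) + t * I))) * conj (∫ v : ↥(adelicUnipotent (↥(maximalRealSubfield L)) L (IsCMField.complexConj L) 2), flatSectionU φ' (conj ((σ₀ : ℂ) + t * I)) (((quasiSplit (↥(maximalRealSubfield L)) L (IsCMField.complexConj L) 2).toAdelic (weylLongU ((IsCMField.complexConj L : L ≃ₐ[↥(maximalRealSubfield L)] L) : L →+* L) (rfl : (StdForm.antidiagonal 2).over L = (StdForm.antidiagonal 2).over L))) * ((v : (quasiSplit (↥(maximalRealSubfield L)) L (IsCMField.complexConj L) 2).Adelic) * (k : (quasiSplit (↥(maximalRealSubfield L))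 L (IsCMField.complexConj L) 2).Adelic))) ∂ν))) (μK.prod (volume : Measure ℝ)) := by
  haveI := t2Space_adeleRing_of_numberField L
  haveI := locallyCompactSpace_adeleRing' L
  haveI := secondCountableTopology_adeleRing L
  haveI : SecondCountableTopology (quasiSplit (↥(maximalRealSubfield L)) L (IsCMField.complexConj L) 2).Adelic := inferInstanceAs (SecondCountableTopology (adelic (↥(maximalRealSubfield L)) L (IsCMField.complexConj L) 2 ((StdForm.antidiagonal 2).over L)))
  haveI := sigmaFinite_haar_adelicUnipotent_cm_two L ν
  have hCφ : 0 ≤ Cφ := (norm_nonneg _).trans (hφC 1)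
  have hHc : Continuous fun g : (quasiSplit (↥(maximalRealSubfield L)) L (IsCMField.complexConj L) 2).Adelic => (borelHeight g : ℝ) := NNReal.continuous_coe.comp continuous_borelHeight
  obtain ⟨hGc, hGi⟩ := continuous_and_integrable_norm_mellin_neg hf hfs hf0 σ₀
  -- measurability: `(k, t, v) ↦ (φ′H^{z̄_t})(w₀ v k)` Borel ⇒ `(k,t) ↦ I(z̄_t,k)` Borel
  have hmW : Continuous fun q : (((standardMaximalCompactGL 2 L).comap (adelicVal (↥(maximalRealSubfield L)) L (IsCMField.complexConj L) 2 ((StdForm.antidiagonal 2).over L)) : Subgroup (quasiSplit (↥(maximalRealSubfield L)) L (IsCMField.complexConj L) 2).Adelic) × ℝ) × ↥(adelicUnipotent (↥(maximalRealSubfield L)) L (IsCMField.complexConj L) 2) => ((quasiSplit (↥(maximalRealSubfield L)) L (IsCMField.complexConj L) 2).toAdelic (weylLongU ((IsCMField.complexConj L : L ≃ₐ[↥(maximalRealSubfield L)] L) : L →+* L) (rfl : (StdForm.antidiagonal 2).over L = (StdForm.antidiagonal 2).over L))) * ((q.2 : (quasiSplit (↥(maximalRealSubfield L)) L (IsCMField.complexConj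 L) 2).Adelic) * (q.1.1 : (quasiSplit (↥(maximalRealSubfield L)) L (IsCMField.complexConj L) 2).Adelic)) :=
    continuous_const.mul ((continuous_subtype_val.comp continuous_snd).mul (continuous_subtype_val.comp (continuous_fst.comp continuous_fst)))
  have hR : Measurable fun q : (((standardMaximalCompactGL 2 L).comap (adelicVal (↥(maximalRealSubfield L)) L (IsCMField.complexConj L) 2 ((StdForm.antidiagonal 2).over L)) : Subgroup (quasiSplit (↥(maximalRealSubfield L)) L (IsCMField.complexConj L) 2).Adelic) × ℝ) × ↥(adelicUnipotent (↥(maximalRealSubfield L)) L (IsCMField.complexConj L) 2) => flatSectionU φ' (conj ((σ₀ : ℂ) + q.1.2 * I)) (((quasiSplit (↥(maximalRealSubfield L)) L (IsCMField.complexConj L) 2).toAdelic (weylLongU ((IsCMField.complexConj L : L ≃ₐ[↥(maximalRealSubfield L)] L) : L →+* L) (rfl : (StdForm.antidiagonal 2).over L = (StdForm.antidiagonal 2).over L))) * ((q.2 : (quasiSplit (↥(maximalRealSubfield L)) L (IsCMField.complexConj L) 2).Adelic) * (q.1.1 : (quasiSplit (↥(maximalRealSubfield L)) L (IsCMField.complexConj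 L) 2).Adelic))) := by
    simp only [flatSectionU_apply]
    exact (hφ'c.measurable.comp hmW.measurable).mul (((continuous_ofReal.comp hHc).measurable.comp hmW.measurable).pow (by fun_prop))
  set Ic : ((standardMaximalCompactGL 2 L).comap (adelicVal (↥(maximalRealSubfield L)) L (IsCMField.complexConj L) 2 ((StdForm.antidiagonal 2).over L)) : Subgroup (quasiSplit (↥(maximalRealSubfield L)) L (IsCMField.complexConj L) 2).Adelic) × ℝ → ℂ := fun p => ∫ v : ↥(adelicUnipotent (↥(maximalRealSubfield L)) L (IsCMField.complexConj L) 2), flatSectionU φ' (conj ((σ₀ : ℂ) + p.2 * I)) (((quasiSplit (↥(maximalRealSubfield L)) L (IsCMField.complexConj L) 2).toAdelic (weylLongU ((IsCMField.complexConj L : L ≃ₐ[↥(maximalRealSubfield L)] L) : L →+* L) (rfl : (StdForm.antidiagonal 2).over L = (StdForm.antidiagonal 2).over L))) * ((v : (quasiSplit (↥(maximalRealSubfield L)) L (IsCMField.complexConj L) 2).Adelic) * (p.1 : (quasiSplit (↥(maximalRealSubfield L)) L (IsCMField.complexConj L) 2).Adelic))) ∂ν with hIcdef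
  have hIcm : Measurable Ic := (hR.stronglyMeasurable.integral_prod_right' (ν := ν)).measurable
  have hmf : Continuous fun t : ℝ => mellin f (-((σ₀ : ℂ) + t * I)) := (differentiable_mellin hf.continuous hfs hf0).continuous.comp (by fun_prop : Continuous fun t : ℝ => -((σ₀ : ℂ) + t * I))
  have hmg : Continuous fun t : ℝ => mellin f' (-conj ((σ₀ : ℂ) + t * I)) := (differentiable_mellin hf'.continuous hf's hf'0).continuous.comp (by fun_prop : Continuous fun t : ℝ => -conj ((σ₀ : ℂ) + t * I))
  have hF1 : Measurable fun p : ((standardMaximalCompactGL 2 L).comap (adelicVal (↥(maximalRealSubfield L)) L (IsCMField.complexConj L) 2 ((StdForm.antidiagonal 2).over L)) : Subgroup (quasiSplit (↥(maximalRealSubfield L)) L (IsCMField.complexConj L) 2).Adelic) × ℝ => φ (p.1 : (quasiSplit (↥(maximalRealSubfield L)) L (IsCMField.complexConj L) 2).Adelic) := hφc.measurable.comp (measurable_subtype_coe.comp measurable_fst)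
  have hF2 : Measurable fun p : ((standardMaximalCompactGL 2 L).comap (adelicVal (↥(maximalRealSubfield L)) L (IsCMField.complexConj L) 2 ((StdForm.antidiagonal 2).over L)) : Subgroup (quasiSplit (↥(maximalRealSubfield L)) L (IsCMField.complexConj L) 2).Adelic) × ℝ => mellin f (-((σ₀ : ℂ) + p.2 * I)) * conj (mellin f' (-conj ((σ₀ : ℂ) + p.2 * I))) := (hmf.measurable.comp measurable_snd).mul (continuous_conj.measurable.comp (hmg.measurable.comp measurable_snd))
  have hF3 : Measurable fun p : ((standardMaximalCompactGL 2 L).comap (adelicVal (↥(maximalRealSubfield L)) L (IsCMField.complexConj L) 2 ((StdForm.antidiagonal 2).over L)) : Subgroup (quasiSplit (↥(maximalRealSubfield L)) L (IsCMField.complexConj L) 2).Adelic) × ℝ => conj (Ic p) := continuous_conj.measurable.comp hIcm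
  have hFm' : Measurable fun p : ((standardMaximalCompactGL 2 L).comap (adelicVal (↥(maximalRealSubfield L)) L (IsCMField.complexConj L) 2 ((StdForm.antidiagonal 2).over L)) : Subgroup (quasiSplit (↥(maximalRealSubfield L)) L (IsCMField.complexConj L) 2).Adelic) × ℝ => φ (p.1 : (quasiSplit (↥(maximalRealSubfield L)) L (IsCMField.complexConj L) 2).Adelic) * (mellin f (-((σ₀ : ℂ) + p.2 * I)) * conj (mellin f' (-conj ((σ₀ : ℂ) + p.2 * I))) * conj (Ic p)) := hF1.mul (hF2.mul hF3)
  have hFm : Measurable (Function.uncurry fun (k : ((standardMaximalCompactGL 2 L).comap (adelicVal (↥(maximalRealSubfield L)) L (IsCMField.complexConj L) 2 ((StdForm.antidiagonal 2).over L)) : Subgroup (quasiSplit (↥(maximalRealSubfield L)) L (IsCMField.complexConj L) 2).Adelic)) (t : ℝ) => φ (k : (quasiSplit (↥(maximalRealSubfield L)) L (IsCMField.complexConj L) 2).Adelic) * (mellin f (-((σ₀ : ℂ) + t * I)) * conj (mellin f' (-conj ((σ₀ : ℂ) + t * I))) * conj (∫ v : ↥(adelicUnipotent (↥(maximalRealSubfield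 L)) L (IsCMField.complexConj L) 2), flatSectionU φ' (conj ((σ₀ : ℂ) + t * I)) (((quasiSplit (↥(maximalRealSubfield L)) L (IsCMField.complexConj L) 2).toAdelic (weylLongU ((IsCMField.complexConj L : L ≃ₐ[↥(maximalRealSubfield L)] L) : L →+* L) (rfl : (StdForm.antidiagonal 2).over L = (StdForm.antidiagonal 2).over L))) * ((v : (quasiSplit (↥(maximalRealSubfield L)) L (IsCMField.complexConj L) 2).Adelic) * (k : (quasiSplit (↥(maximalRealSubfield L)) L (IsCMField.complexConj L) 2).Adelic))) ∂ν))) := hFm'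
  -- domination
  have hIb : ∀ (t : ℝ) (k : ((standardMaximalCompactGL 2 L).comap (adelicVal (↥(maximalRealSubfield L)) L (IsCMField.complexConj L) 2 ((StdForm.antidiagonal 2).over L)) : Subgroup (quasiSplit (↥(maximalRealSubfield L)) L (IsCMField.complexConj L) 2).Adelic)), ‖∫ v : ↥(adelicUnipotent (↥(maximalRealSubfield L)) L (IsCMField.complexConj L) 2), flatSectionU φ' (conj ((σ₀ : ℂ) + t * I)) (((quasiSplit (↥(maximalRealSubfield L)) L (IsCMField.complexConj L) 2).toAdelic (weylLongU ((IsCMField.complexConj L : L ≃ₐ[↥(maximalRealSubfield L)] L) : L →+* L) (rfl : (StdForm.antidiagonal 2).over L = (StdForm.antidiagonal 2).over L))) * ((v : (quasiSplit (↥(maximalRealSubfield L)) L (IsCMField.complexConj L) 2).Adelic) * (k : (quasiSplit (↥(maximalRealSubfield L)) L (IsCMField.complexConj L) 2).Adelic))) ∂ν‖ ≤ Cφ' * (∫ v : ↥(adelicUnipotent (↥(maximalRealSubfield L)) L (IsCMField.complexConj L) 2), (borelHeight (((quasiSplit (↥(maximalRealSubfield L)) L (IsCMField.complexConj L) 2).toAdelic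 (weylLongU ((IsCMField.complexConj L : L ≃ₐ[↥(maximalRealSubfield L)] L) : L →+* L) (rfl : (StdForm.antidiagonal 2).over L = (StdForm.antidiagonal 2).over L))) * (v : (quasiSplit (↥(maximalRealSubfield L)) L (IsCMField.complexConj L) 2).Adelic)) : ℝ) ^ σ₀ ∂ν) := fun t k => by
    have h := norm_integral_flatSectionU_weylLongU_maximalCompact_le_cm_two L ν h𝓕N h𝓕c hφ'C (z := conj ((σ₀ : ℂ) + t * I)) (by simpa using hσ₀) k
    simpa using h
  set B' : ℝ := ∫ r in Ioi (0 : ℝ), r ^ (-σ₀ - 1) * ‖f' r‖ with hB'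
  have hgb : ∀ t : ℝ, ‖mellin f' (-conj ((σ₀ : ℂ) + t * I))‖ ≤ B' := fun t => by
    have h := norm_mellin_le f' (-conj ((σ₀ : ℂ) + t * I))
    have hre : (-conj ((σ₀ : ℂ) + t * I)).re = -σ₀ := by simp
    rwa [hre] at h
  have hB'0 : 0 ≤ B' := (norm_nonneg _).trans (hgb 0)
  have hc₀0 : 0 ≤ Cφ' * (∫ v : ↥(adelicUnipotent (↥(maximalRealSubfield L)) L (IsCMField.complexConj L) 2), (borelHeight (((quasiSplit (↥(maximalRealSubfield L)) L (IsCMField.complexConj L) 2).toAdelic (weylLongU ((IsCMField.complexConj L : L ≃ₐ[↥(maximalRealSubfield L)] L) : L →+* L) (rfl : (StdForm.antidiagonal 2).over L = (StdForm.antidiagonal 2).over L))) * (v : (quasiSplit (↥(maximalRealSubfield L)) L (IsCMField.complexConj L) 2).Adelic)) : ℝ) ^ σ₀ ∂ν) := (norm_nonneg _).trans (hIb 0 1)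
  have hdom : Integrable (fun p : ((standardMaximalCompactGL 2 L).comap (adelicVal (↥(maximalRealSubfield L)) L (IsCMField.complexConj L) 2 ((StdForm.antidiagonal 2).over L)) : Subgroup (quasiSplit (↥(maximalRealSubfield L)) L (IsCMField.complexConj L) 2).Adelic) × ℝ => Cφ * (‖mellin f (-((σ₀ : ℂ) + p.2 * I))‖ * (B' * (Cφ' * (∫ v : ↥(adelicUnipotent (↥(maximalRealSubfield L)) L (IsCMField.complexConj L) 2), (borelHeight (((quasiSplit (↥(maximalRealSubfield L)) L (IsCMField.complexConj L) 2).toAdelic (weylLongU ((IsCMField.complexConj L : L ≃ₐ[↥(maximalRealSubfield L)] L) : L →+* L) (rfl : (StdForm.antidiagonal 2).over L = (StdForm.antidiagonal 2).over L))) * (v : (quasiSplit (↥(maximalRealSubfield L)) L (IsCMField.complexConj L) 2).Adelic)) : ℝ) ^ σ₀ ∂ν))))) (μK.prod (volume : Measure ℝ)) := by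
    have h := (integrable_const (μ := μK) Cφ).mul_prod (hGi.mul_const (B' * (Cφ' * (∫ v : ↥(adelicUnipotent (↥(maximalRealSubfield L)) L (IsCMField.complexConj L) 2), (borelHeight (((quasiSplit (↥(maximalRealSubfield L)) L (IsCMField.complexConj L) 2).toAdelic (weylLongU ((IsCMField.complexConj L : L ≃ₐ[↥(maximalRealSubfield L)] L) : L →+* L) (rfl : (StdForm.antidiagonal 2).over L = (StdForm.antidiagonal 2).over L))) * (v : (quasiSplit (↥(maximalRealSubfield L)) L (IsCMField.complexConj L) 2).Adelic)) : ℝ) ^ σ₀ ∂ν))))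
    exact h
  refine hdom.mono' hFm.aestronglyMeasurable (ae_of_all _ fun p => ?_)
  obtain ⟨k, t⟩ := p
  simp only [Function.uncurry_apply_pair]
  rw [norm_mul, norm_mul, norm_mul, Complex.norm_conj, Complex.norm_conj]
  exact mul_le_mul (hφC _) (by rw [mul_assoc]; exact mul_le_mul_of_nonneg_left (mul_le_mul (hgb t) (hIb t k) (norm_nonneg _) hB'0) (norm_nonneg _))
    (by positivity) hCφ

variable [MeasurableSpace (AdeleRing (𝓞 L) L)ˣ] [BorelSpace (AdeleRing (𝓞 L) L)ˣ]

/-! ## §2 (SD) in vector-Gram currency -/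

/-- **(SD) IN VECTOR-GRAM CURRENCY.**  Data as in ★ W-b; one `C > 0` such that for every UNITARY SELF-DUAL `χ` (`χʷ = χ`), continuous bounded `χ`-sections `φ, φ′`, `f, f′ ∈ C²_c((0,∞))`,
`σ₀ > 1` (`z = σ₀ + it`, `I(w,k) = ∫_{N(𝔸)}(φ′H^w)(w₀ v k) dν`):
**`∫_X θ_{f,φ}·conj θ_{f′,φ′} dμ = C·(2π)⁻¹∫_ℝ f̃(−z)·( (∫_{K_U} φ conj φ′ dμ_K)·conj f̃′(−(1 − z̄)) + B_z·conj f̃′(−z̄) ) dt`**, `B_z = (ν𝓕)⁻¹·∫_{K_U} φ(k)·conj I(z̄,k) dμ_K` — the `hSD` shape of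
★ `K2E1ChiSectionPlancherelSelfDualCMTwo` with `⟪v_b,v_a⟫ ↦ ∫ φ conj φ′`, `⟪v_b, M z v_a⟫ ↦ B_z`. [cite: MoeglinWaldspurger1995, II.2.1] [cite: Titchmarsh1948, Thm 71–72] -/
theorem chiPseudoEisenstein_inner_product_selfDual_vectorGram_cm_two
    (μ : Measure (quasiSplit (↥(maximalRealSubfield L)) L (IsCMField.complexConj L) 2).automorphicQuotient) [(quasiSplit (↥(maximalRealSubfield L)) L (IsCMField.complexConj L) 2).IsAutomorphicMeasure μ]
    (νG : Measure (quasiSplit (↥(maximalRealSubfield L)) L (IsCMField.complexConj L) 2).Adelic) [νG.IsHaarMeasure] [νG.IsInvInvariant]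
    (μK : Measure ((standardMaximalCompactGL 2 L).comap (adelicVal (↥(maximalRealSubfield L)) L (IsCMField.complexConj L) 2 ((StdForm.antidiagonal 2).over L)) : Subgroup (quasiSplit (↥(maximalRealSubfield L)) L (IsCMField.complexConj L) 2).Adelic)) [μK.IsHaarMeasure]
    (νI : Measure (AdeleRing (𝓞 L) L)ˣ) [νI.IsHaarMeasure]
    {𝓕I : Set (AdeleRing (𝓞 L) L)ˣ} (h𝓕I : IsIdeleClassDomain L 𝓕I)
    (ν : Measure ↥(adelicUnipotent (↥(maximalRealSubfield L)) L (IsCMField.complexConj L) 2)) [ν.IsHaarMeasure] {𝓕 : Set ↥(adelicUnipotent (↥(maximalRealSubfield L)) L (IsCMField.complexConj L) 2)}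
    (h𝓕N : IsFundamentalDomain ↥(rationalUnipotent (↥(maximalRealSubfield L)) L (IsCMField.complexConj L) 2) 𝓕 ν) (h𝓕c : IsCompact (closure 𝓕)) (h𝓕₀ : ν 𝓕 ≠ 0) :
    ∃ C : ℝ, 0 < C ∧
      ∀ {χ : HeckeCharacter L} {φ φ' : (quasiSplit (↥(maximalRealSubfield L)) L (IsCMField.complexConj L) 2).Adelic → ℂ}, χ.IsUnitary → reflectChar (IsCMField.complexConj L) χ = χ →
        IsChiSection χ φ → Continuous φ → ∀ {Cφ : ℝ}, (∀ x, ‖φ x‖ ≤ Cφ) →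
        IsChiSection χ φ' → Continuous φ' → ∀ {Cφ' : ℝ}, (∀ x, ‖φ' x‖ ≤ Cφ') →
      ∀ {f f' : ℝ → ℂ}, ContDiff ℝ 2 f → HasCompactSupport f → tsupport f ⊆ Ioi 0 → ContDiff ℝ 2 f' → HasCompactSupport f' → tsupport f' ⊆ Ioi 0 →
      ∀ {σ₀ : ℝ}, 1 < σ₀ →
        Integrable (fun x : (quasiSplit (↥(maximalRealSubfield L)) L (IsCMField.complexConj L) 2).automorphicQuotient =>
            (quasiSplit (↥(maximalRealSubfield L)) L (IsCMField.complexConj L) 2).quotFun (eisensteinSeriesU (fun g : (quasiSplit (↥(maximalRealSubfield L)) L (IsCMField.complexConj L) 2).Adelic => f (borelHeight g : ℝ) * φ g)) x * conj ((quasiSplit (↥(maximalRealSubfield L)) L (IsCMField.complexConj L) 2).quotFun (eisensteinSeriesU (fun g : (quasiSplit (↥(maximalRealSubfield L)) L (IsCMField.complexConj L) 2).Adelic => f' (borelHeight g : ℝ) * φ' g)) x)) μ ∧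
        ∫ x, (quasiSplit (↥(maximalRealSubfield L)) L (IsCMField.complexConj L) 2).quotFun (eisensteinSeriesU (fun g : (quasiSplit (↥(maximalRealSubfield L)) L (IsCMField.complexConj L) 2).Adelic => f (borelHeight g : ℝ) * φ g)) x * conj ((quasiSplit (↥(maximalRealSubfield L)) L (IsCMField.complexConj L) 2).quotFun (eisensteinSeriesU (fun g : (quasiSplit (↥(maximalRealSubfield L)) L (IsCMField.complexConj L) 2).Adelic => f' (borelHeight g : ℝ) * φ' g)) x) ∂μ = (C : ℂ) * ((((2 * π)⁻¹ : ℝ) : ℂ) * ∫ t : ℝ, mellin f (-((σ₀ : ℂ) + t * I)) * ((∫ k : ((standardMaximalCompactGL 2 L).comap (adelicVal (↥(maximalRealSubfield L)) L (IsCMField.complexConj L) 2 ((StdForm.antidiagonal 2).over L)) : Subgroup (quasiSplit (↥(maximalRealSubfield L)) L (IsCMField.complexConj L) 2).Adelic), φ (k : (quasiSplit (↥(maximalRealSubfield L)) L (IsCMField.complexConj L) 2).Adelic) * conj (φ' (k : (quasiSplit (↥(maximalRealSubfield L)) L (IsCMField.complexConj L) 2).Adelic)) ∂μK) * conj (mellin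 f' (-(1 - conj ((σ₀ : ℂ) + t * I)))) + (((((ν 𝓕).toReal⁻¹ : ℝ)) : ℂ) * ∫ k : ((standardMaximalCompactGL 2 L).comap (adelicVal (↥(maximalRealSubfield L)) L (IsCMField.complexConj L) 2 ((StdForm.antidiagonal 2).over L)) : Subgroup (quasiSplit (↥(maximalRealSubfield L)) L (IsCMField.complexConj L) 2).Adelic), φ (k : (quasiSplit (↥(maximalRealSubfield L)) L (IsCMField.complexConj L) 2).Adelic) * conj (∫ v : ↥(adelicUnipotent (↥(maximalRealSubfield L)) L (IsCMField.complexConj L) 2), flatSectionU φ' (conj ((σ₀ : ℂ) + t * I)) (((quasiSplit (↥(maximalRealSubfield L)) L (IsCMField.complexConj L) 2).toAdelic (weylLongU ((IsCMField.complexConj L : L ≃ₐ[↥(maximalRealSubfield L)] L) : L →+* L) (rfl : (StdForm.antidiagonal 2).over L = (StdForm.antidiagonal 2).over L))) * ((v : (quasiSplit (↥(maximalRealSubfield L)) L (IsCMField.complexConj L) 2).Adelic) * (k : (quasiSplit (↥(maximalRealSubfield L)) L (IsCMField.complexConj L) 2).Adelic))) ∂ν) ∂μK) * conj (mellin f' (-conj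 ((σ₀ : ℂ) + t * I))))) := by
  haveI := t2Space_adeleRing_of_numberField L
  haveI := locallyCompactSpace_adeleRing' L
  have hKc : IsCompact ((((standardMaximalCompactGL 2 L).comap (adelicVal (↥(maximalRealSubfield L)) L (IsCMField.complexConj L) 2 ((StdForm.antidiagonal 2).over L)) : Subgroup (quasiSplit (↥(maximalRealSubfield L)) L (IsCMField.complexConj L) 2).Adelic)) : Set (quasiSplit (↥(maximalRealSubfield L)) L (IsCMField.complexConj L) 2).Adelic) := isCompact_comap_adelicVal_standardMaximalCompactGL
  haveI : CompactSpace ((standardMaximalCompactGL 2 L).comap (adelicVal (↥(maximalRealSubfield L)) L (IsCMField.complexConj L) 2 ((StdForm.antidiagonal 2).over L)) : Subgroup (quasiSplit (↥(maximalRealSubfield L)) L (IsCMField.complexConj L) 2).Adelic) := isCompact_iff_compactSpace.1 hKc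
  haveI : IsFiniteMeasure μK := CompactSpace.isFiniteMeasure
  obtain ⟨C, hC, hH⟩ := chiPseudoEisenstein_inner_product_selfDual_cm_two L μ νG μK νI h𝓕I ν h𝓕N h𝓕c h𝓕₀
  refine ⟨C, hC, ?_⟩
  intro χ φ φ' hχu hsd hφ hφc Cφ hφC hφ' hφ'c Cφ' hφ'C f f' hf hfs hf0 hf' hf's hf'0 σ₀ hσ₀
  obtain ⟨hInt, hEq⟩ := hH hχu hsd hφ hφc hφC hφ' hφ'c hφ'C hf hfs hf0 hf' hf's hf'0 hσ₀
  refine ⟨hInt, ?_⟩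
  have hCφ : 0 ≤ Cφ := (norm_nonneg _).trans (hφC 1)
  obtain ⟨hGc, hGi⟩ := continuous_and_integrable_norm_mellin_neg hf hfs hf0 σ₀
  have hmf : Continuous fun t : ℝ => mellin f (-((σ₀ : ℂ) + t * I)) := (differentiable_mellin hf.continuous hfs hf0).continuous.comp (by fun_prop : Continuous fun t : ℝ => -((σ₀ : ℂ) + t * I))
  have hmg : Continuous fun t : ℝ => mellin f' (-conj ((σ₀ : ℂ) + t * I)) := (differentiable_mellin hf'.continuous hf's hf'0).continuous.comp (by fun_prop : Continuous fun t : ℝ => -conj ((σ₀ : ℂ) + t * I))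
  have hm1 : Continuous fun t : ℝ => mellin f' (conj ((σ₀ : ℂ) + t * I) - 1) := (differentiable_mellin hf'.continuous hf's hf'0).continuous.comp ((continuous_conj.comp (by fun_prop)).sub continuous_const)
  have hIb : ∀ (t : ℝ) (k : ((standardMaximalCompactGL 2 L).comap (adelicVal (↥(maximalRealSubfield L)) L (IsCMField.complexConj L) 2 ((StdForm.antidiagonal 2).over L)) : Subgroup (quasiSplit (↥(maximalRealSubfield L)) L (IsCMField.complexConj L) 2).Adelic)), ‖∫ v : ↥(adelicUnipotent (↥(maximalRealSubfield L)) L (IsCMField.complexConj L) 2), flatSectionU φ' (conj ((σ₀ : ℂ) + t * I)) (((quasiSplit (↥(maximalRealSubfield L)) L (IsCMField.complexConj L) 2).toAdelic (weylLongU ((IsCMField.complexConj L : L ≃ₐ[↥(maximalRealSubfield L)] L) : L →+* L) (rfl : (StdForm.antidiagonal 2).over L = (StdForm.antidiagonal 2).over L))) * ((v : (quasiSplit (↥(maximalRealSubfield L)) L (IsCMField.complexConj L) 2).Adelic) * (k : (quasiSplit (↥(maximalRealSubfield L)) L (IsCMField.complexConj L) 2).Adelic))) ∂ν‖ ≤ Cφ'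 * (∫ v : ↥(adelicUnipotent (↥(maximalRealSubfield L)) L (IsCMField.complexConj L) 2), (borelHeight (((quasiSplit (↥(maximalRealSubfield L)) L (IsCMField.complexConj L) 2).toAdelic (weylLongU ((IsCMField.complexConj L : L ≃ₐ[↥(maximalRealSubfield L)] L) : L →+* L) (rfl : (StdForm.antidiagonal 2).over L = (StdForm.antidiagonal 2).over L))) * (v : (quasiSplit (↥(maximalRealSubfield L)) L (IsCMField.complexConj L) 2).Adelic)) : ℝ) ^ σ₀ ∂ν) := fun t k => by
    have h := norm_integral_flatSectionU_weylLongU_maximalCompact_le_cm_two L ν h𝓕N h𝓕c hφ'C (z := conj ((σ₀ : ℂ) + t * I)) (by simpa using hσ₀) k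
    simpa using h
  -- (1) Fubini: the `K_U`-integral of the `t`-integral is the `t`-integral of the `K_U`-integral
  have hswap := integral_integral_swap (integrable_selfDual_w0_prod_cm_two L ν h𝓕N h𝓕c μK hφc hφC hφ'c hφ'C hf hfs hf0 hf' hf's hf'0 hσ₀)
  have h2a : ∀ k : ((standardMaximalCompactGL 2 L).comap (adelicVal (↥(maximalRealSubfield L)) L (IsCMField.complexConj L) 2 ((StdForm.antidiagonal 2).over L)) : Subgroup (quasiSplit (↥(maximalRealSubfield L)) L (IsCMField.complexConj L) 2).Adelic), φ (k : (quasiSplit (↥(maximalRealSubfield L)) L (IsCMField.complexConj L) 2).Adelic) * ((((2 * π)⁻¹ : ℝ) : ℂ) * ∫ y : ℝ, mellin f (-((σ₀ : ℂ) + y * I)) * conj (mellin f' (-conj ((σ₀ : ℂ) + y * I))) * conj (∫ v : ↥(adelicUnipotent (↥(maximalRealSubfield L)) L (IsCMField.complexConj L) 2), flatSectionU φ' (conj ((σ₀ : ℂ) + y * I)) (((quasiSplit (↥(maximalRealSubfield L)) L (IsCMField.complexConj L) 2).toAdelic (weylLongU ((IsCMField.complexConj L : L ≃ₐ[↥(maximalRealSubfield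 L)] L) : L →+* L) (rfl : (StdForm.antidiagonal 2).over L = (StdForm.antidiagonal 2).over L))) * ((v : (quasiSplit (↥(maximalRealSubfield L)) L (IsCMField.complexConj L) 2).Adelic) * (k : (quasiSplit (↥(maximalRealSubfield L)) L (IsCMField.complexConj L) 2).Adelic))) ∂ν)) = (((2 * π)⁻¹ : ℝ) : ℂ) * ∫ t : ℝ, φ (k : (quasiSplit (↥(maximalRealSubfield L)) L (IsCMField.complexConj L) 2).Adelic) * (mellin f (-((σ₀ : ℂ) + t * I)) * conj (mellin f' (-conj ((σ₀ : ℂ) + t * I))) * conj (∫ v : ↥(adelicUnipotent (↥(maximalRealSubfield L)) L (IsCMField.complexConj L) 2), flatSectionU φ' (conj ((σ₀ : ℂ) + t * I)) (((quasiSplit (↥(maximalRealSubfield L)) L (IsCMField.complexConj L) 2).toAdelic (weylLongU ((IsCMField.complexConj L : L ≃ₐ[↥(maximalRealSubfield L)] L) : L →+* L) (rfl : (StdForm.antidiagonal 2).over L = (StdForm.antidiagonal 2).over L))) * ((v : (quasiSplit (↥(maximalRealSubfield L)) L (IsCMField.complexConj L) 2).Adelic) * (k : (quasiSplit (↥(maximalRealSubfield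 L)) L (IsCMField.complexConj L) 2).Adelic))) ∂ν)) := fun k => by
    calc φ (k : (quasiSplit (↥(maximalRealSubfield L)) L (IsCMField.complexConj L) 2).Adelic) * ((((2 * π)⁻¹ : ℝ) : ℂ) * ∫ y : ℝ, mellin f (-((σ₀ : ℂ) + y * I)) * conj (mellin f' (-conj ((σ₀ : ℂ) + y * I))) * conj (∫ v : ↥(adelicUnipotent (↥(maximalRealSubfield L)) L (IsCMField.complexConj L) 2), flatSectionU φ' (conj ((σ₀ : ℂ) + y * I)) (((quasiSplit (↥(maximalRealSubfield L)) L (IsCMField.complexConj L) 2).toAdelic (weylLongU ((IsCMField.complexConj L : L ≃ₐ[↥(maximalRealSubfield L)] L) : L →+* L) (rfl : (StdForm.antidiagonal 2).over L = (StdForm.antidiagonal 2).over L))) * ((v : (quasiSplit (↥(maximalRealSubfield L)) L (IsCMField.complexConj L) 2).Adelic) * (k : (quasiSplit (↥(maximalRealSubfield L)) L (IsCMField.complexConj L) 2).Adelic))) ∂ν))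
        = (((2 * π)⁻¹ : ℝ) : ℂ) * (φ (k : (quasiSplit (↥(maximalRealSubfield L)) L (IsCMField.complexConj L) 2).Adelic) * ∫ y : ℝ, mellin f (-((σ₀ : ℂ) + y * I)) * conj (mellin f' (-conj ((σ₀ : ℂ) + y * I))) * conj (∫ v : ↥(adelicUnipotent (↥(maximalRealSubfield L)) L (IsCMField.complexConj L) 2), flatSectionU φ' (conj ((σ₀ : ℂ) + y * I)) (((quasiSplit (↥(maximalRealSubfield L)) L (IsCMField.complexConj L) 2).toAdelic (weylLongU ((IsCMField.complexConj L : L ≃ₐ[↥(maximalRealSubfield L)] L) : L →+* L) (rfl : (StdForm.antidiagonal 2).over L = (StdForm.antidiagonal 2).over L))) * ((v : (quasiSplit (↥(maximalRealSubfield L)) L (IsCMField.complexConj L) 2).Adelic) * (k : (quasiSplit (↥(maximalRealSubfield L)) L (IsCMField.complexConj L) 2).Adelic))) ∂ν)) := by ring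
      _ = (((2 * π)⁻¹ : ℝ) : ℂ) * ∫ t : ℝ, φ (k : (quasiSplit (↥(maximalRealSubfield L)) L (IsCMField.complexConj L) 2).Adelic) * (mellin f (-((σ₀ : ℂ) + t * I)) * conj (mellin f' (-conj ((σ₀ : ℂ) + t * I))) * conj (∫ v : ↥(adelicUnipotent (↥(maximalRealSubfield L)) L (IsCMField.complexConj L) 2), flatSectionU φ' (conj ((σ₀ : ℂ) + t * I)) (((quasiSplit (↥(maximalRealSubfield L)) L (IsCMField.complexConj L) 2).toAdelic (weylLongU ((IsCMField.complexConj L : L ≃ₐ[↥(maximalRealSubfield L)] L) : L →+* L) (rfl : (StdForm.antidiagonal 2).over L = (StdForm.antidiagonal 2).over L))) * ((v : (quasiSplit (↥(maximalRealSubfield L)) L (IsCMField.complexConj L) 2).Adelic) * (k : (quasiSplit (↥(maximalRealSubfield L)) L (IsCMField.complexConj L) 2).Adelic))) ∂ν)) := by rw [← integral_const_mul]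
  have h2b : ∀ t : ℝ, ∫ k : ((standardMaximalCompactGL 2 L).comap (adelicVal (↥(maximalRealSubfield L)) L (IsCMField.complexConj L) 2 ((StdForm.antidiagonal 2).over L)) : Subgroup (quasiSplit (↥(maximalRealSubfield L)) L (IsCMField.complexConj L) 2).Adelic), φ (k : (quasiSplit (↥(maximalRealSubfield L)) L (IsCMField.complexConj L) 2).Adelic) * (mellin f (-((σ₀ : ℂ) + t * I)) * conj (mellin f' (-conj ((σ₀ : ℂ) + t * I))) * conj (∫ v : ↥(adelicUnipotent (↥(maximalRealSubfield L)) L (IsCMField.complexConj L) 2), flatSectionU φ' (conj ((σ₀ : ℂ) + t * I)) (((quasiSplit (↥(maximalRealSubfield L)) L (IsCMField.complexConj L) 2).toAdelic (weylLongU ((IsCMField.complexConj L : L ≃ₐ[↥(maximalRealSubfield L)] L) : L →+* L) (rfl : (StdForm.antidiagonal 2).over L = (StdForm.antidiagonal 2).over L))) * ((v : (quasiSplit (↥(maximalRealSubfield L)) L (IsCMField.complexConj L) 2).Adelic) * (k : (quasiSplit (↥(maximalRealSubfield L)) L (IsCMField.complexConj L) 2).Adelic))) ∂ν)) ∂μK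 = mellin f (-((σ₀ : ℂ) + t * I)) * ((∫ k : ((standardMaximalCompactGL 2 L).comap (adelicVal (↥(maximalRealSubfield L)) L (IsCMField.complexConj L) 2 ((StdForm.antidiagonal 2).over L)) : Subgroup (quasiSplit (↥(maximalRealSubfield L)) L (IsCMField.complexConj L) 2).Adelic), φ (k : (quasiSplit (↥(maximalRealSubfield L)) L (IsCMField.complexConj L) 2).Adelic) * conj (∫ v : ↥(adelicUnipotent (↥(maximalRealSubfield L)) L (IsCMField.complexConj L) 2), flatSectionU φ' (conj ((σ₀ : ℂ) + t * I)) (((quasiSplit (↥(maximalRealSubfield L)) L (IsCMField.complexConj L) 2).toAdelic (weylLongU ((IsCMField.complexConj L : L ≃ₐ[↥(maximalRealSubfield L)] L) : L →+* L) (rfl : (StdForm.antidiagonal 2).over L = (StdForm.antidiagonal 2).over L))) * ((v : (quasiSplit (↥(maximalRealSubfield L)) L (IsCMField.complexConj L) 2).Adelic) * (k : (quasiSplit (↥(maximalRealSubfield L)) L (IsCMField.complexConj L) 2).Adelic))) ∂ν) ∂μK) * conj (mellin f' (-conj ((σ₀ : ℂ) + t * I)))) := fun t => by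
    rw [← integral_mul_const, ← integral_const_mul]
    exact integral_congr_ae (ae_of_all _ fun k => by ring)
  have h2 : ∫ k : ((standardMaximalCompactGL 2 L).comap (adelicVal (↥(maximalRealSubfield L)) L (IsCMField.complexConj L) 2 ((StdForm.antidiagonal 2).over L)) : Subgroup (quasiSplit (↥(maximalRealSubfield L)) L (IsCMField.complexConj L) 2).Adelic), φ (k : (quasiSplit (↥(maximalRealSubfield L)) L (IsCMField.complexConj L) 2).Adelic) * ((((2 * π)⁻¹ : ℝ) : ℂ) * ∫ y : ℝ, mellin f (-((σ₀ : ℂ) + y * I)) * conj (mellin f' (-conj ((σ₀ : ℂ) + y * I))) * conj (∫ v : ↥(adelicUnipotent (↥(maximalRealSubfield L)) L (IsCMField.complexConj L) 2), flatSectionU φ' (conj ((σ₀ : ℂ) + y * I)) (((quasiSplit (↥(maximalRealSubfield L)) L (IsCMField.complexConj L) 2).toAdelic (weylLongU ((IsCMField.complexConj L : L ≃ₐ[↥(maximalRealSubfield L)] L) : L →+* L) (rfl : (StdForm.antidiagonal 2).over L = (StdForm.antidiagonal 2).over L))) * ((v : (quasiSplit (↥(maximalRealSubfield L)) L (IsCMField.complexConj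 L) 2).Adelic) * (k : (quasiSplit (↥(maximalRealSubfield L)) L (IsCMField.complexConj L) 2).Adelic))) ∂ν)) ∂μK = (((2 * π)⁻¹ : ℝ) : ℂ) * ∫ t : ℝ, mellin f (-((σ₀ : ℂ) + t * I)) * ((∫ k : ((standardMaximalCompactGL 2 L).comap (adelicVal (↥(maximalRealSubfield L)) L (IsCMField.complexConj L) 2 ((StdForm.antidiagonal 2).over L)) : Subgroup (quasiSplit (↥(maximalRealSubfield L)) L (IsCMField.complexConj L) 2).Adelic), φ (k : (quasiSplit (↥(maximalRealSubfield L)) L (IsCMField.complexConj L) 2).Adelic) * conj (∫ v : ↥(adelicUnipotent (↥(maximalRealSubfield L)) L (IsCMField.complexConj L) 2), flatSectionU φ' (conj ((σ₀ : ℂ) + t * I)) (((quasiSplit (↥(maximalRealSubfield L)) L (IsCMField.complexConj L) 2).toAdelic (weylLongU ((IsCMField.complexConj L : L ≃ₐ[↥(maximalRealSubfield L)] L) : L →+* L) (rfl : (StdForm.antidiagonal 2).over L = (StdForm.antidiagonal 2).over L))) * ((v : (quasiSplit (↥(maximalRealSubfield L)) L (IsCMField.complexConj L) 2).Adelic) *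 (k : (quasiSplit (↥(maximalRealSubfield L)) L (IsCMField.complexConj L) 2).Adelic))) ∂ν) ∂μK) * conj (mellin f' (-conj ((σ₀ : ℂ) + t * I)))) := by
    rw [integral_congr_ae (ae_of_all _ h2a), integral_const_mul]
    exact congrArg (fun w : ℂ => (((2 * π)⁻¹ : ℝ) : ℂ) * w) (hswap.trans (integral_congr_ae (ae_of_all _ h2b)))
  -- (2) integrability of the two `t`-integrands (to merge them)
  have hB : ∀ t : ℝ, ‖∫ k : ((standardMaximalCompactGL 2 L).comap (adelicVal (↥(maximalRealSubfield L)) L (IsCMField.complexConj L) 2 ((StdForm.antidiagonal 2).over L)) : Subgroup (quasiSplit (↥(maximalRealSubfield L)) L (IsCMField.complexConj L) 2).Adelic), φ (k : (quasiSplit (↥(maximalRealSubfield L)) L (IsCMField.complexConj L) 2).Adelic) * conj (∫ v : ↥(adelicUnipotent (↥(maximalRealSubfield L)) L (IsCMField.complexConj L) 2), flatSectionU φ' (conj ((σ₀ : ℂ) + t * I)) (((quasiSplit (↥(maximalRealSubfield L)) L (IsCMField.complexConj L) 2).toAdelic (weylLongU ((IsCMField.complexConj L : L ≃ₐ[↥(maximalRealSubfield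 L)] L) : L →+* L) (rfl : (StdForm.antidiagonal 2).over L = (StdForm.antidiagonal 2).over L))) * ((v : (quasiSplit (↥(maximalRealSubfield L)) L (IsCMField.complexConj L) 2).Adelic) * (k : (quasiSplit (↥(maximalRealSubfield L)) L (IsCMField.complexConj L) 2).Adelic))) ∂ν) ∂μK‖ ≤ Cφ * (Cφ' * (∫ v : ↥(adelicUnipotent (↥(maximalRealSubfield L)) L (IsCMField.complexConj L) 2), (borelHeight (((quasiSplit (↥(maximalRealSubfield L)) L (IsCMField.complexConj L) 2).toAdelic (weylLongU ((IsCMField.complexConj L : L ≃ₐ[↥(maximalRealSubfield L)] L) : L →+* L) (rfl : (StdForm.antidiagonal 2).over L = (StdForm.antidiagonal 2).over L))) * (v : (quasiSplit (↥(maximalRealSubfield L)) L (IsCMField.complexConj L) 2).Adelic)) : ℝ) ^ σ₀ ∂ν)) * μK.real Set.univ := fun t =>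
    norm_integral_le_of_norm_le_const (ae_of_all _ fun k => by rw [norm_mul, Complex.norm_conj]; exact mul_le_mul (hφC _) (hIb t k) (norm_nonneg _) hCφ)
  have hI1 : Integrable fun t : ℝ => mellin f (-((σ₀ : ℂ) + t * I)) * ((∫ k : ((standardMaximalCompactGL 2 L).comap (adelicVal (↥(maximalRealSubfield L)) L (IsCMField.complexConj L) 2 ((StdForm.antidiagonal 2).over L)) : Subgroup (quasiSplit (↥(maximalRealSubfield L)) L (IsCMField.complexConj L) 2).Adelic), φ (k : (quasiSplit (↥(maximalRealSubfield L)) L (IsCMField.complexConj L) 2).Adelic) * conj (φ' (k : (quasiSplit (↥(maximalRealSubfield L)) L (IsCMField.complexConj L) 2).Adelic)) ∂μK) * conj (mellin f' (-(1 - conj ((σ₀ : ℂ) + t * I))))) := by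
    have hm1' : Continuous fun t : ℝ => mellin f' (-(1 - conj ((σ₀ : ℂ) + t * I))) := by
      simp_rw [neg_sub]
      exact hm1
    refine Integrable.mono' (hGi.mul_const (‖∫ k : ((standardMaximalCompactGL 2 L).comap (adelicVal (↥(maximalRealSubfield L)) L (IsCMField.complexConj L) 2 ((StdForm.antidiagonal 2).over L)) : Subgroup (quasiSplit (↥(maximalRealSubfield L)) L (IsCMField.complexConj L) 2).Adelic), φ (k : (quasiSplit (↥(maximalRealSubfield L)) L (IsCMField.complexConj L) 2).Adelic) * conj (φ' (k : (quasiSplit (↥(maximalRealSubfield L)) L (IsCMField.complexConj L) 2).Adelic)) ∂μK‖ * ∫ r in Ioi 0, r ^ (σ₀ - 1 - 1) * ‖f' r‖)) (hmf.mul (continuous_const.mul (continuous_conj.comp hm1'))).aestronglyMeasurable (ae_of_all _ fun t => ?_)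
    rw [norm_mul, norm_mul, Complex.norm_conj]
    refine mul_le_mul_of_nonneg_left (mul_le_mul_of_nonneg_left ?_ (norm_nonneg _)) (norm_nonneg _)
    have h := norm_mellin_le f' (-(1 - conj ((σ₀ : ℂ) + t * I)))
    have hre : (-(1 - conj ((σ₀ : ℂ) + t * I))).re = σ₀ - 1 := by simp
    rwa [hre] at h
  have hI2 : Integrable fun t : ℝ => mellin f (-((σ₀ : ℂ) + t * I)) * ((((((ν 𝓕).toReal⁻¹ : ℝ)) : ℂ) * ∫ k : ((standardMaximalCompactGL 2 L).comap (adelicVal (↥(maximalRealSubfield L)) L (IsCMField.complexConj L) 2 ((StdForm.antidiagonal 2).over L)) : Subgroup (quasiSplit (↥(maximalRealSubfield L)) L (IsCMField.complexConj L) 2).Adelic), φ (k : (quasiSplit (↥(maximalRealSubfield L)) L (IsCMField.complexConj L) 2).Adelic) * conj (∫ v : ↥(adelicUnipotent (↥(maximalRealSubfield L)) L (IsCMField.complexConj L) 2), flatSectionU φ' (conj ((σ₀ : ℂ) + t * I)) (((quasiSplit (↥(maximalRealSubfield L)) L (IsCMField.complexConj L) 2).toAdelic (weylLongU ((IsCMField.complexConj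 L : L ≃ₐ[↥(maximalRealSubfield L)] L) : L →+* L) (rfl : (StdForm.antidiagonal 2).over L = (StdForm.antidiagonal 2).over L))) * ((v : (quasiSplit (↥(maximalRealSubfield L)) L (IsCMField.complexConj L) 2).Adelic) * (k : (quasiSplit (↥(maximalRealSubfield L)) L (IsCMField.complexConj L) 2).Adelic))) ∂ν) ∂μK) * conj (mellin f' (-conj ((σ₀ : ℂ) + t * I)))) := by
    have h := ((integrable_selfDual_w0_prod_cm_two L ν h𝓕N h𝓕c μK hφc hφC hφ'c hφ'C hf hfs hf0 hf' hf's hf'0 hσ₀).integral_prod_right).const_mul (((((ν 𝓕).toReal⁻¹ : ℝ)) : ℂ))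
    refine h.congr (ae_of_all _ fun t => ?_)
    dsimp only
    rw [show (∫ x : ((standardMaximalCompactGL 2 L).comap (adelicVal (↥(maximalRealSubfield L)) L (IsCMField.complexConj L) 2 ((StdForm.antidiagonal 2).over L)) : Subgroup (quasiSplit (↥(maximalRealSubfield L)) L (IsCMField.complexConj L) 2).Adelic), Function.uncurry (fun (k : ((standardMaximalCompactGL 2 L).comap (adelicVal (↥(maximalRealSubfield L)) L (IsCMField.complexConj L) 2 ((StdForm.antidiagonal 2).over L)) : Subgroup (quasiSplit (↥(maximalRealSubfield L)) L (IsCMField.complexConj L) 2).Adelic)) (t : ℝ) => φ (k : (quasiSplit (↥(maximalRealSubfield L)) L (IsCMField.complexConj L) 2).Adelic) * (mellin f (-((σ₀ : ℂ) + t * I)) * conj (mellin f' (-conj ((σ₀ : ℂ) + t * I))) * conj (∫ v : ↥(adelicUnipotent (↥(maximalRealSubfield L)) L (IsCMField.complexConj L) 2), flatSectionU φ' (conj ((σ₀ : ℂ) + t * I)) (((quasiSplit (↥(maximalRealSubfield L)) L (IsCMField.complexConj L) 2).toAdelic (weylLongU ((IsCMField.complexConj L : L ≃ₐ[↥(maximalRealSubfield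 L)] L) : L →+* L) (rfl : (StdForm.antidiagonal 2).over L = (StdForm.antidiagonal 2).over L))) * ((v : (quasiSplit (↥(maximalRealSubfield L)) L (IsCMField.complexConj L) 2).Adelic) * (k : (quasiSplit (↥(maximalRealSubfield L)) L (IsCMField.complexConj L) 2).Adelic))) ∂ν))) (x, t) ∂μK) = ∫ k : ((standardMaximalCompactGL 2 L).comap (adelicVal (↥(maximalRealSubfield L)) L (IsCMField.complexConj L) 2 ((StdForm.antidiagonal 2).over L)) : Subgroup (quasiSplit (↥(maximalRealSubfield L)) L (IsCMField.complexConj L) 2).Adelic), φ (k : (quasiSplit (↥(maximalRealSubfield L)) L (IsCMField.complexConj L) 2).Adelic) * (mellin f (-((σ₀ : ℂ) + t * I)) * conj (mellin f' (-conj ((σ₀ : ℂ) + t * I))) * conj (∫ v : ↥(adelicUnipotent (↥(maximalRealSubfield L)) L (IsCMField.complexConj L) 2), flatSectionU φ' (conj ((σ₀ : ℂ) + t * I)) (((quasiSplit (↥(maximalRealSubfield L)) L (IsCMField.complexConj L) 2).toAdelic (weylLongU ((IsCMField.complexConj L : L ≃ₐ[↥(maximalRealSubfield L)] L) : L →+*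 L) (rfl : (StdForm.antidiagonal 2).over L = (StdForm.antidiagonal 2).over L))) * ((v : (quasiSplit (↥(maximalRealSubfield L)) L (IsCMField.complexConj L) 2).Adelic) * (k : (quasiSplit (↥(maximalRealSubfield L)) L (IsCMField.complexConj L) 2).Adelic))) ∂ν)) ∂μK from rfl, h2b t]
    ring
  -- (3) assembly
  have hT1 : ((((2 * π)⁻¹ : ℝ) : ℂ) * ∫ y : ℝ, mellin f (-((σ₀ : ℂ) + y * I)) * conj (mellin f' (conj ((σ₀ : ℂ) + y * I) - 1))) * ∫ k : ((standardMaximalCompactGL 2 L).comap (adelicVal (↥(maximalRealSubfield L)) L (IsCMField.complexConj L) 2 ((StdForm.antidiagonal 2).over L)) : Subgroup (quasiSplit (↥(maximalRealSubfield L)) L (IsCMField.complexConj L) 2).Adelic), φ (k : (quasiSplit (↥(maximalRealSubfield L)) L (IsCMField.complexConj L) 2).Adelic) * conj (φ' (k : (quasiSplit (↥(maximalRealSubfield L)) L (IsCMField.complexConj L) 2).Adelic)) ∂μK =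
      (((2 * π)⁻¹ : ℝ) : ℂ) * ∫ t : ℝ, mellin f (-((σ₀ : ℂ) + t * I)) * ((∫ k : ((standardMaximalCompactGL 2 L).comap (adelicVal (↥(maximalRealSubfield L)) L (IsCMField.complexConj L) 2 ((StdForm.antidiagonal 2).over L)) : Subgroup (quasiSplit (↥(maximalRealSubfield L)) L (IsCMField.complexConj L) 2).Adelic), φ (k : (quasiSplit (↥(maximalRealSubfield L)) L (IsCMField.complexConj L) 2).Adelic) * conj (φ' (k : (quasiSplit (↥(maximalRealSubfield L)) L (IsCMField.complexConj L) 2).Adelic)) ∂μK) * conj (mellin f' (-(1 - conj ((σ₀ : ℂ) + t * I))))) := by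
    rw [mul_assoc, ← integral_mul_const]
    congr 1
    refine integral_congr_ae (ae_of_all _ fun t => ?_)
    dsimp only
    rw [neg_sub]
    ring
  have hT2 : ((ν 𝓕).toReal⁻¹ : ℝ) • ∫ k : ((standardMaximalCompactGL 2 L).comap (adelicVal (↥(maximalRealSubfield L)) L (IsCMField.complexConj L) 2 ((StdForm.antidiagonal 2).over L)) : Subgroup (quasiSplit (↥(maximalRealSubfield L)) L (IsCMField.complexConj L) 2).Adelic), φ (k : (quasiSplit (↥(maximalRealSubfield L)) L (IsCMField.complexConj L) 2).Adelic) * ((((2 * π)⁻¹ : ℝ) : ℂ) * ∫ y : ℝ, mellin f (-((σ₀ : ℂ) + y * I)) * conj (mellin f' (-conj ((σ₀ : ℂ) + y * I))) * conj (∫ v : ↥(adelicUnipotent (↥(maximalRealSubfield L)) L (IsCMField.complexConj L) 2), flatSectionU φ' (conj ((σ₀ : ℂ) + y * I)) (((quasiSplit (↥(maximalRealSubfield L)) L (IsCMField.complexConj L) 2).toAdelic (weylLongU ((IsCMField.complexConj L : L ≃ₐ[↥(maximalRealSubfield L)] L) : L →+* L) (rfl : (StdForm.antidiagonal 2).over L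 = (StdForm.antidiagonal 2).over L))) * ((v : (quasiSplit (↥(maximalRealSubfield L)) L (IsCMField.complexConj L) 2).Adelic) * (k : (quasiSplit (↥(maximalRealSubfield L)) L (IsCMField.complexConj L) 2).Adelic))) ∂ν)) ∂μK = (((2 * π)⁻¹ : ℝ) : ℂ) * ∫ t : ℝ, mellin f (-((σ₀ : ℂ) + t * I)) * ((((((ν 𝓕).toReal⁻¹ : ℝ)) : ℂ) * ∫ k : ((standardMaximalCompactGL 2 L).comap (adelicVal (↥(maximalRealSubfield L)) L (IsCMField.complexConj L) 2 ((StdForm.antidiagonal 2).over L)) : Subgroup (quasiSplit (↥(maximalRealSubfield L)) L (IsCMField.complexConj L) 2).Adelic), φ (k : (quasiSplit (↥(maximalRealSubfield L)) L (IsCMField.complexConj L) 2).Adelic) * conj (∫ v : ↥(adelicUnipotent (↥(maximalRealSubfield L)) L (IsCMField.complexConj L) 2), flatSectionU φ' (conj ((σ₀ : ℂ) + t * I)) (((quasiSplit (↥(maximalRealSubfield L)) L (IsCMField.complexConj L) 2).toAdelic (weylLongU ((IsCMField.complexConj L : L ≃ₐ[↥(maximalRealSubfield L)] L) : L →+* L)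 (rfl : (StdForm.antidiagonal 2).over L = (StdForm.antidiagonal 2).over L))) * ((v : (quasiSplit (↥(maximalRealSubfield L)) L (IsCMField.complexConj L) 2).Adelic) * (k : (quasiSplit (↥(maximalRealSubfield L)) L (IsCMField.complexConj L) 2).Adelic))) ∂ν) ∂μK) * conj (mellin f' (-conj ((σ₀ : ℂ) + t * I)))) := by
    rw [h2, Complex.real_smul, ← mul_assoc, mul_comm (((((ν 𝓕).toReal⁻¹ : ℝ)) : ℂ)), mul_assoc, ← integral_const_mul]
    congr 1
    exact integral_congr_ae (ae_of_all _ fun t => by ring)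
  rw [hEq, hT1, hT2, ← mul_add, ← integral_add hI1 hI2]
  congr 2
  exact integral_congr_ae (ae_of_all _ fun t => by ring)

end Summit.HodgeConjecture.HodgeConjecture.Cruxes.H413.K2E1ChiPseudoEisensteinSelfDualVectorGramCMTwo

end
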